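import Literature.Topology.FourManifolds.ThetaFour
import Literature.Topology.FourManifolds.HomotopySpheresInverseProofs
import HarnessLib

/-!
# `Θ₄ = 0` along Kervaire–Milnor's proof: the named fact `isHCobordant_sphere_of_homotopySphere_four` reduced to its printed ingredients

Topic `Literature/Topology/FourManifolds`; first layer of the decomposition of the named fact
`Literature.Topology.FourManifolds.isHCobordant_sphere_of_homotopySphere_four` (`ThetaFour.lean`:
every homotopy 4-sphere is smoothly h-cobordant to `S⁴`, i.e. `Θ₄ = 0` in Kervaire–Milnor's
h-cobordism sense), in the style of the tree's decomposition of `Θ₇ = bP₈`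
(`HomotopySpheresBP.lean`).

Kervaire–Milnor, *Groups of homotopy spheres I*, Ann. of Math. 77 (1963), prove `Θ₄ = 0` (table of
orders, p. 504: `n = 4 ↦ 1`) entirely inside Part I, by the chain

* **Thm. 3.1** (p. 508): every homotopy sphere `Σ` is s-parallelizable — the tree's named fact
  `Literature.Topology.FourManifolds.HomotopySphere.isStablyParallelizable` (all `n`; `n = 4` is
  Case 2 of the printed proof, via the Hirzebruch signature theorem);
* **§4** (pp. 510–512): for s-parallelizable closed `M` the Pontryagin–Thom sets `p(M) ⊂ Πₙ`
  satisfy: `0 ∈ p(M)` iff `M` bounds a parallelizable manifold (Lemma 4.2), `p(Σ)` is a coset of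
  `p(Sⁿ) = im Jₙ` (Lemma 4.5), so `Θₙ / bPₙ₊₁ ↪ Πₙ / p(Sⁿ)`; and `Π₄ = 0` (table p. 512), whence
  `Θ₄ = bP₅`: every homotopy 4-sphere bounds a parallelizable manifold — vendored here, with
  Thm. 3.1 factored out exactly as for `n = 7`, as the named fact
  `Literature.Topology.FourManifolds.HomotopySphere.boundsParallelizable_of_isStablyParallelizable_four`;
* **Thm. 5.1** (p. 512; proof §§5–6, completed with Thm. 6.6, p. 526): "If a homotopy sphere of
  dimension `2k` bounds an s-parallelizable manifold `M`, then it bounds a contractible manifold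
  `M₁`" (so `bP₂ₖ₊₁ = 0`), here `k = 2` — vendored as the named fact
  `Literature.Topology.FourManifolds.HomotopySphere.boundsContractible_of_nullCobordism_isStablyParallelizable_four`;
* **Lemma 2.3** (p. 506, direction `⇐`): a closed simply connected manifold bounding a
  contractible manifold is h-cobordant to `Sⁿ` — the tree's named fact
  `Literature.Topology.FourManifolds.isHCobordant_sphere_of_boundsContractible`, itself already
  reduced to its homotopy-theoretic half
  `Literature.Topology.FourManifolds.NullCobordism.isHomotopyEquiv_compl_ball_of_contractibleSpace`
  (`isHCobordant_sphere_of_boundsContractible_of_isHomotopyEquiv`, `HomotopySpheresInverseProofs.lean`;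
  the smooth half, removing an open ball, is proved in `BallRemovalCobordism.lean`);

together with `π₁(Σ) = π₁(S⁴) = 1` (tree theorem `HomotopySphere.simplyConnectedSpace`) and the
triviality "parallelizable ⇒ s-parallelizable" (`IsParallelizable.isStablyParallelizable`,
`Spin.lean`; Kervaire–Milnor Lemma 3.4 is the converse for connected manifolds with boundary).

## Main statements

* `HomotopySphere.boundsParallelizable_of_isStablyParallelizable_four` (named fact, §4 at `n = 4`)
  and `HomotopySphere.boundsParallelizable_four_of` (**proved**): Thm. 3.1 and the §4 fact give
  `Θ₄ = bP₅` — every homotopy 4-sphere bounds a parallelizable manifold. `Θ₄ = bP₅` is stated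
  there in unfolded form (`∀ S : HomotopySphere 4, S.BoundsParallelizable`) and is deliberately NOT
  vendored as a named fact of its own: it is exactly the conjunction of the two leaves Thm. 3.1 and
  §4 (`n = 4`), each a named fact already, so a separate named fact would carry no proof obligation
  beyond theirs (contrast `HomotopySphere.boundsParallelizable_seven`, `HomotopySpheresBP.lean`,
  which is consumed on its own by the `Θ₇` assembly).
* `HomotopySphere.boundsContractible_of_nullCobordism_isStablyParallelizable_four` (named fact,
  Thm. 5.1 at `k = 2`) and `HomotopySphere.boundsContractible_four_of` (**proved**): `Θ₄ = bP₅` and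
  Thm. 5.1 at `k = 2` give `Θ₄ = 0` in the bounding form — every homotopy 4-sphere bounds a
  contractible manifold, `∀ S : HomotopySphere 4, BoundsContractible 4 S.carrier`. This bounding form
  is NOT a named fact of its own (D-0026 review of the split, 2026-08-15: the former hub `def`
  `HomotopySphere.boundsContractible_four` was merged back into the target): by Kervaire–Milnor's
  Lemma 2.3, BOTH directions of which are theorems of the tree
  (`isHCobordant_sphere_of_boundsContractible_holds`, `boundsContractible_of_isHCobordant_sphere_holds`),
  it is equivalent to the target fact `isHCobordant_sphere_of_homotopySphere_four` itself
  (`HomotopySphere.forall_boundsContractible_four_iff_isHCobordant_sphere`,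
  `SmaleHomologySpheresFiveSixKervaireMilnor.lean`), so as a separate fact it would restate the
  target rather than reduce it.
* `isHCobordant_sphere_of_homotopySphere_four_of` (**proved**): Lemma 2.3 (`⇐`) and the bounding
  form give the target fact; `isHCobordant_sphere_of_homotopySphere_four_of_leaves`
  (**proved**): the target from the four leaves — the homotopy theory of Lemma 2.3 (since
  discharged: `NullCobordism.isHomotopyEquiv_compl_ball_of_contractibleSpace_holds`,
  `HomotopySpheresInverseDischarge.lean`), Thm. 3.1, §4 (`n = 4`) and Thm. 5.1 (`k = 2`).

Nothing here discharges the target: the three remaining leaves are theories absent from Mathlib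
and from the tree (obstruction theory, Bott periodicity and the signature theorem for Thm. 3.1; the
Pontryagin–Thom construction and `Π₄ = π₄ˢ = 0` for §4; framed surgery on `5`-manifolds for
Thm. 5.1), while the Lemma 2.3 leaf (Whitehead's theorem, excision, Poincaré–Lefschetz duality) has
been discharged downstream.

## Design and faithfulness

* **Dimension.** Both new facts are the `n = 4` (`k = 2`) instances of statements Kervaire–Milnor
  print for general `n` (resp. all `k`; for `k = 1` "every homotopy 2-sphere is actually
  diffeomorphic to `S²`", p. 513, and the surgery proof is for `k > 1`), exactly as the tree's
  `_seven` facts specialise §4 to `n = 7`; only these instances are consumed.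
* **Orientations.** Kervaire–Milnor's manifolds are compact oriented and "`Σ` bounds `M`" is an
  equality `Σ = bM` of oriented manifolds; the tree's `NullCobordism` / `BoundsParallelizable` /
  `BoundsContractible` are unoriented. For a homotopy sphere of positive dimension (connected) the
  two readings agree: an s-parallelizable (a fortiori a parallelizable or contractible) `W` is
  orientable, and `∂(-W) = -∂W`, so `Σ` bounds such a `W` unorientedly iff `(Σ, o)` does for either
  orientation `o` (as recorded in the module docstring of `HomotopySpheresBP.lean`). Hence each
  unoriented statement below follows from the printed one and conversely.
* **s-parallelizable** is Kervaire–Milnor's definition (p. 508: `τ ⊕ ε¹` is trivial), rendered by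
  the tree's `IsStablyParallelizable` (a global continuous framing of `TW ⊕ ℝ`, `Spin.lean`), for
  the bounding 5-manifold with its boundary model `𝓡∂ 5`; Thm. 5.1 is stated with this printed
  hypothesis, and the weaker-looking "bounds a parallelizable manifold" produced by §4 feeds it
  through `IsParallelizable.isStablyParallelizable`.
* All manifolds live in `Type`: `HomotopySphere 4` has its carrier in `Type` and the two ends of a
  tree `Cobordism` share a universe with `𝕊⁴ : Type`.

## References

* M. Kervaire, J. Milnor, *Groups of homotopy spheres I*, Ann. of Math. (2) 77 (1963), 504–537:
  §1 and table p. 504; Lemma 2.3 (p. 506); Thm. 3.1 and Lemma 3.4 (pp. 508–509); §4: Lemmas 4.2,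
  4.5, Thm. 4.1 and table p. 512; Thm. 5.1 (p. 512), p. 513, Thm. 6.6 (p. 526).
  doi:10.2307/1970128 [KervaireMilnorAnnals1963]
* C. T. C. Wall, *Killing the middle homotopy groups of odd dimensional manifolds*, Trans. AMS 103
  (1962) 421–433 (the independent proof of Thm. 5.1 cited by Kervaire–Milnor as [29]).
-/

noncomputable section

open scoped Manifold ContDiff

namespace Literature.Topology.FourManifolds

namespace HomotopySphere

/-! ### §4 at `n = 4`: `Θ₄ = bP₅` -/

/-- **An s-parallelizable homotopy `4`-sphere bounds a parallelizable manifold** (named fact): the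
contribution of Kervaire–Milnor's §4 to `Θ₄ = 0`, with Thm. 3.1
(`HomotopySphere.isStablyParallelizable`) factored out. Kervaire–Milnor, *Groups of homotopy
spheres I* (1963), §4: for an s-parallelizable closed `Mⁿ ⊂ Sⁿ⁺ᵏ` (`k > n + 1`; normal bundle
trivial by Lemma 3.3) the Pontryagin–Thom construction applied to the normal framings `φ` gives a
subset `p(M) = {p(M, φ)} ⊂ Πₙ = πₙ₊ₖ(Sᵏ)` (p. 510); Lemma 4.2: "The subset `p(M) ⊂ Πₙ` contains
the zero element of `Πₙ` if and only if `M` bounds a parallelizable manifold"; Lemma 4.5: for a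
homotopy sphere `Σ`, `p(Σ)` is a coset of the subgroup `p(Sⁿ) ⊂ Πₙ`, so that `Θₙ / bPₙ₊₁` is
isomorphic to a subgroup of `Πₙ / p(Sⁿ)` (proof of Thm. 4.1, p. 512); and `Π₄ = 0` (table p. 512:
the stable `4`-stem `π₄ˢ = πₖ₊₄(Sᵏ)`, `k ≥ 6`, vanishes), so that `Π₄ / p(S⁴) = 0`, `p(Σ) = {0}` for every
s-parallelizable homotopy 4-sphere `Σ`, and `Σ` bounds a parallelizable manifold: `Θ₄ = bP₅`.
Here "bounds a parallelizable manifold" is the tree's unoriented `HomotopySphere.BoundsParallelizable`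
(a compact smooth 5-manifold `W` with `∂W = Σ` and a global framing of `TW`), equivalent to the
printed oriented reading since a parallelizable `W` is orientable and `∂(-W) = -∂W`. Together with
Thm. 3.1 this gives `Θ₄ = bP₅`, every homotopy `4`-sphere bounds a parallelizable manifold
(`boundsParallelizable_four_of`, proved). Not proved
here: the Pontryagin–Thom construction, framed cobordism and `π₄ˢ = 0` are absent from Mathlib and
from the tree. [cite: KervaireMilnorAnnals1963, §4: p. 510 (p(M) ⊂ Πₙ), Lemma 4.2, Lemma 4.5, proof of Thm. 4.1 and table p. 512 (Π₄ = 0)] -/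
def boundsParallelizable_of_isStablyParallelizable_four : Prop :=
  ∀ S : HomotopySphere 4, IsStablyParallelizable (𝓡 4) S.carrier → S.BoundsParallelizable

/-- **`Θ₄ = bP₅` from its two printed ingredients**: if every homotopy sphere is s-parallelizable
(Kervaire–Milnor 1963, Thm. 3.1; `isStablyParallelizable`) and every s-parallelizable homotopy
`4`-sphere bounds a parallelizable manifold (§4 with `Π₄ = 0`;
`boundsParallelizable_of_isStablyParallelizable_four`), then every homotopy `4`-sphere bounds a
parallelizable (compact, smooth, `5`-dimensional) manifold (`HomotopySphere.BoundsParallelizable`)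
— Kervaire–Milnor's `Θ₄ = bP₅`: `Θ₄ / bP₅` is isomorphic to a subgroup of `Π₄ / p(S⁴)` (proof of
Thm. 4.1, p. 512) and `Π₄ = 0` (table p. 512). This is the order of the argument on p. 510:
"Given an s-parallelizable closed manifold `M` …". The conclusion is stated in unfolded form and
is not a separate named fact of the tree (it is exactly the conjunction of the two leaves; see the
module docstring); it feeds `boundsContractible_four_of`.
[cite: KervaireMilnorAnnals1963, Thm. 3.1 and §4 (p. 510; proof of Thm. 4.1 and table p. 512: Θ₄/bP₅ ↪ Π₄/p(S⁴) = 0)] -/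
theorem boundsParallelizable_four_of (ha : isStablyParallelizable)
    (hb : boundsParallelizable_of_isStablyParallelizable_four) :
    ∀ S : HomotopySphere 4, S.BoundsParallelizable :=
  fun S => hb S (ha 4 S)

/-! ### Thm. 5.1 at `k = 2`: `bP₅ = 0` -/

/-- **Kervaire–Milnor's Theorem 5.1 for `k = 2`** (named fact). Kervaire–Milnor, *Groups of
homotopy spheres I* (1963), Thm. 5.1, p. 512: "If a homotopy sphere of dimension `2k` bounds an
s-parallelizable manifold `M`, then it bounds a contractible manifold `M₁`" ("This section, and §6
which follows, will prove that the groups `bP₂ₖ₊₁` are zero"). Printed proof for `k > 1` (p. 513;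
`k = 1` being the classification of surfaces): kill `π₁(M), …, π_{k-1}(M)` by spherical
modifications keeping `M` s-parallelizable (Lemmas 5.2–5.4, Thm. 5.5), then `πₖ(M) = Hₖ(M)` by
*framed* spherical modifications (Lemma 5.6 and §6), reaching a `k`-connected `M₁` with
`bM₁ = bM`, which is contractible by Poincaré duality ("This completes the proof of Theorem 5.1",
Thm. 6.6, p. 526). Here, for `k = 2`: if a homotopy `4`-sphere `Σ` is the boundary of a compact
smooth `5`-manifold `W` (`NullCobordism 4 Σ`: a smooth embedding `Σ ↪ W` onto `∂W`) whose stable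
tangent bundle `TW ⊕ ℝ` admits a global framing (`IsStablyParallelizable (𝓡∂ (4 + 1)) W`, the
model of `NullCobordism 4`; Kervaire–Milnor's "s-parallelizable", p. 508), then `Σ` bounds a contractible compact smooth
`5`-manifold (`BoundsContractible 4 Σ`). Orientations: Kervaire–Milnor's "bounds" is oriented
(`Σ = bM`); an s-parallelizable `W` is orientable and `Σ` is connected, so `Σ = ∂W` unorientedly
gives `(Σ, o) = b(±W)` with `±W` s-parallelizable, and the printed theorem yields the present
(unoriented) conclusion. Not proved here: surgery (spherical modifications), the homotopy and
homology computations of §§5–6 and Poincaré–Lefschetz duality are absent from Mathlib and from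
the tree. [cite: KervaireMilnorAnnals1963, Thm. 5.1 (p. 512; proof pp. 513–526, Thm. 6.6)] -/
def boundsContractible_of_nullCobordism_isStablyParallelizable_four : Prop :=
  ∀ (S : HomotopySphere 4) (c : NullCobordism.{0} 4 S.carrier),
    IsStablyParallelizable (𝓡∂ (4 + 1)) c.W → BoundsContractible 4 S.carrier

/-- **`Θ₄ = 0` in Kervaire–Milnor's bounding form, from `Θ₄ = bP₅` and `bP₅ = 0`**: if every
homotopy `4`-sphere bounds a parallelizable manifold (`Θ₄ = bP₅`: Thm. 3.1 and §4, table p. 512,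
assembled by `boundsParallelizable_four_of`) and Thm. 5.1 holds for `k = 2`
(`boundsContractible_of_nullCobordism_isStablyParallelizable_four`: "the group `bPₙ₊₁` is zero for
`n` even (§5, 6)", p. 512), then every homotopy `4`-sphere bounds a contractible (compact, smooth,
`5`-dimensional) manifold (`BoundsContractible`) — a parallelizable bounding manifold being
s-parallelizable (`IsParallelizable.isStablyParallelizable`; Kervaire–Milnor 1963, p. 508 and
Lemma 3.4). By Lemma 2.3 this bounding form is `Θ₄ = 0` (table p. 504, `n = 4 ↦ 1`;
`isHCobordant_sphere_of_homotopySphere_four_of`), and conversely (Lemma 2.3 `⇒`), so it is kept as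
the conclusion of this theorem and not as a named fact (it would restate
`isHCobordant_sphere_of_homotopySphere_four`; see the module docstring).
[cite: KervaireMilnorAnnals1963, §4–§5 (p. 512: bP₅ = 0 = Θ₄/bP₅)] -/
theorem boundsContractible_four_of (hP : ∀ S : HomotopySphere 4, S.BoundsParallelizable)
    (h51 : boundsContractible_of_nullCobordism_isStablyParallelizable_four) :
    ∀ S : HomotopySphere 4, BoundsContractible 4 S.carrier := fun S => by
  obtain ⟨c, hc⟩ := hP S
  exact h51 S c hc.isStablyParallelizable

end HomotopySphere

/-! ### Assembly: `Θ₄ = 0` in the h-cobordism form -/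

/-- **`Θ₄ = 0` (h-cobordism form) from Lemma 2.3 and the bounding form.** GIVEN Kervaire–Milnor's
Lemma 2.3, direction `⇐` (`isHCobordant_sphere_of_boundsContractible`: a closed simply connected
smooth `n`-manifold, `n ≥ 2`, bounding a contractible manifold is h-cobordant to `𝕊ⁿ`; discharged
downstream as `isHCobordant_sphere_of_boundsContractible_holds`, `HomotopySpheresInverseDischarge.lean`)
and `Θ₄ = 0` in the bounding form (every homotopy `4`-sphere bounds a contractible manifold, the
conclusion of `HomotopySphere.boundsContractible_four_of`), every homotopy `4`-sphere is
h-cobordant to `S⁴` (the named fact `isHCobordant_sphere_of_homotopySphere_four`): a homotopy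
`4`-sphere is simply connected (`HomotopySphere.simplyConnectedSpace`, from `π₁(S⁴) = 1`). This is
the proof of Thm. 1.1 / table p. 504 for `n = 4` (Kervaire–Milnor 1963, pp. 506–507 and 512).
[cite: KervaireMilnorAnnals1963, Lemma 2.3 (p. 506) with Thm. 5.1 and §4 (p. 512)] -/
theorem isHCobordant_sphere_of_homotopySphere_four_of
    (h23 : isHCobordant_sphere_of_boundsContractible)
    (hΘ : ∀ S : HomotopySphere 4, BoundsContractible 4 S.carrier) :
    isHCobordant_sphere_of_homotopySphere_four := fun S => by
  haveI := HomotopySphere.simplyConnectedSpace (n := 4) (by norm_num) S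
  exact h23 4 S.carrier (by norm_num) (hΘ S)

/-- **`Θ₄ = 0` from the current leaves of Kervaire–Milnor's proof.** Every homotopy `4`-sphere is
h-cobordant to `S⁴` (`isHCobordant_sphere_of_homotopySphere_four`) GIVEN (i) the homotopy theory
in Lemma 2.3 (`NullCobordism.isHomotopyEquiv_compl_ball_of_contractibleSpace`: excision, Poincaré
duality, Whitehead; its smooth half, removing an open ball from a null-cobordism, is the tree
theorem `NullCobordism.exists_cobordism_sphere_compl_ball_holds`, and (i) itself is since discharged
downstream, `NullCobordism.isHomotopyEquiv_compl_ball_of_contractibleSpace_holds`), (ii) Thm. 3.1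
(`HomotopySphere.isStablyParallelizable`), (iii) §4 at `n = 4`
(`HomotopySphere.boundsParallelizable_of_isStablyParallelizable_four`, `Π₄ = 0`) and (iv) Thm. 5.1
at `k = 2` (`HomotopySphere.boundsContractible_of_nullCobordism_isStablyParallelizable_four`).
[cite: KervaireMilnorAnnals1963, Thm. 1.1 for n = 4: Lemma 2.3, Thm. 3.1, §4, Thm. 5.1] -/
theorem isHCobordant_sphere_of_homotopySphere_four_of_leaves
    (h23b : NullCobordism.isHomotopyEquiv_compl_ball_of_contractibleSpace)
    (h31 : HomotopySphere.isStablyParallelizable)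
    (h4 : HomotopySphere.boundsParallelizable_of_isStablyParallelizable_four)
    (h51 : HomotopySphere.boundsContractible_of_nullCobordism_isStablyParallelizable_four) :
    isHCobordant_sphere_of_homotopySphere_four :=
  isHCobordant_sphere_of_homotopySphere_four_of
    (isHCobordant_sphere_of_boundsContractible_of_isHomotopyEquiv h23b)
    (HomotopySphere.boundsContractible_four_of
      (HomotopySphere.boundsParallelizable_four_of h31 h4) h51)

end Literature.Topology.FourManifolds

end
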